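import Summits.Ventures.HodgeRepro2.T5GlobalRepresentation
import Summits.Ventures.HodgeRepro2.T5LocalIsotropyOfDatum

/-!
# Representation of an element of `K⁺` by a diagonal hermitian form over `K` in every rank, from O'Meara 66:1 ALONE
(cell pub-hodge-repro2, seat p3)

Tier-5 N2 support, rows N2.2.7 / N2.2.9 / N2.8.1 of route/T5-N2-route-3.md. File 171 proved
`exists_sum_mul_star_eq_of_OMeara : OMeara1963_66_1 K⁺ → OMeara1963_63_19 K⁺ → …` (the diagonal hermitian form
`∑ aᵢ wᵢ w̄ᵢ`, `#ι ≥ 2`, represents every `c ∈ K⁺^×` of the right signs), using the display of 63:19 at exactly one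
point: the isotropy of the `(2n+1)`-ary quadratic space `⟨a, −aθ, −c⟩` over `K⁺` at every finite place. File 175
(`T5LocalIsotropyOfDatum.isotropicDiag_datum_local`) proves that isotropy in the kernel from the lane's binary
universality `(U)`; this file is file 171's proof with that one step replaced:
* **`exists_sum_mul_star_eq_of_OMeara66_1`** — the same conclusion from `OMeara1963_66_1 K⁺` alone.
File 177 (T5LandherrGeneralHM) carries the Witt-type induction of file 173 on this theorem, so that Landherr's
uniqueness in every rank holds modulo the Hasse–Minkowski display alone.

Mathlib + this seat's files 171 / 175 and their imports; no new display; no device.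
§8(d): uses an L-value-free non-vanishing device: NO.
-/

namespace Summit.Ventures.HodgeRepro2.T5GlobalRepresentationHM

open Matrix Finset NumberField NumberField.IsCMField IsDedekindDomain IsDedekindDomain.HeightOneSpectrum
open Summit.Ventures.HodgeRepro2.T5HasseMinkowskiDisplays Summit.Ventures.HodgeRepro2.T5HermitianDiagonalSign
  Summit.Ventures.HodgeRepro2.T5ShimuraOfHasseMinkowski Summit.Ventures.HodgeRepro2.T5LandherrInvariants
  Summit.Ventures.HodgeRepro2.T5HermitianGlobalChain Summit.Ventures.HodgeRepro2.T5FinitePlaceCM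
  Summit.Ventures.HodgeRepro2.T5GlobalRepresentation Summit.Ventures.HodgeRepro2.T5LocalIsotropyOfDatum

/-! ## Representation over `K` from the Hasse–Minkowski display alone -/

section Represent

variable {K : Type*} [Field K] [NumberField K] [IsCMField K]

/-- **Representation in every rank from O'Meara 66:1 ALONE:** for `a : ι → K⁺` with non-zero entries, `#ι ≥ 2`,
and `c ∈ K⁺^×` such that at every real embedding `ψ` of `K⁺` some `ψ (a i)` has the sign of `ψ c`, the diagonal
hermitian form `∑ aᵢ wᵢ w̄ᵢ` over `K` represents `c` — file 171's theorem with the local step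
(`OMeara1963_63_19 K⁺` at the `(2n+1)`-ary space `⟨a, −aθ, −c⟩`) supplied by file 175's
`isotropicDiag_datum_local`; the rest of the proof is file 171's verbatim. -/
theorem exists_sum_mul_star_eq_of_OMeara66_1 (hHM : OMeara1963_66_1 (maximalRealSubfield K))
    {ι : Type*} [Fintype ι] [DecidableEq ι]
    {a : ι → maximalRealSubfield K} (ha0 : ∀ i, a i ≠ 0) (hcard : 2 ≤ Fintype.card ι)
    {c : maximalRealSubfield K} (hc0 : c ≠ 0)
    (hreal : ∀ ψ : maximalRealSubfield K →+* ℝ, ∃ i, (0 < ψ (a i) ↔ 0 < ψ c)) :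
    ∃ w : ι → K, ∑ i, algebraMap (maximalRealSubfield K) K (a i) * (w i * star (w i)) =
      algebraMap (maximalRealSubfield K) K c := by
  obtain ⟨θ, y, hθ, hy⟩ := exists_datum K
  have hθ0 : θ ≠ 0 := theta_ne_zero hθ hy
  -- the `(2n+1)`-ary quadratic space over `K⁺`, indexed by `ι ⊕ (ι ⊕ Unit)`
  set q : ι ⊕ (ι ⊕ Unit) → maximalRealSubfield K :=
    Sum.elim a (Sum.elim (fun i => -(a i * θ)) (fun _ => -c)) with hq
  let e : Fin (Fintype.card (ι ⊕ (ι ⊕ Unit))) ≃ ι ⊕ (ι ⊕ Unit) := (Fintype.equivFin _).symm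
  have hm : 5 ≤ Fintype.card (ι ⊕ (ι ⊕ Unit)) := by
    simp only [Fintype.card_sum, Fintype.card_unique]
    omega
  have hiso : IsotropicDiag (maximalRealSubfield K) (q ∘ e) := by
    refine hHM _ (q ∘ e) ?_ ?_ ?_
    · intro j
      simp only [Function.comp]
      rcases e j with i | i | u
      · simpa [q] using ha0 i
      · simpa [q] using mul_ne_zero (ha0 i) hθ0
      · simpa [q] using hc0
    · intro v
      exact (isotropicDiag_comp_equiv e fun j => algebraMap (maximalRealSubfield K)
        (v.adicCompletion (maximalRealSubfield K)) (q j)).mpr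
        (isotropicDiag_datum_local K hθ hy v (by omega) a c ha0 hc0)
    · intro ψ
      obtain ⟨i, hi⟩ := hreal ψ
      have hψc : ψ c ≠ 0 := (map_ne_zero ψ).mpr hc0
      have hψa : ψ (a i) ≠ 0 := (map_ne_zero ψ).mpr (ha0 i)
      rcases lt_or_gt_of_ne hψc with hc | hc
      · -- `ψ c < 0`, so `ψ (a i) < 0`: the coefficient `−ψ c` is positive, `ψ (a i)` negative
        have hai : ψ (a i) < 0 := lt_of_le_of_ne (not_lt.mp fun h => absurd (hi.mp h) (not_lt.mpr hc.le)) hψa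
        refine isotropicDiag_of_pos_of_neg (i := e.symm (Sum.inr (Sum.inr ()))) (j := e.symm (Sum.inl i)) ?_ ?_
        · simp [q, hc]
        · simpa [q] using hai
      · -- `ψ c > 0`, so `ψ (a i) > 0`: `ψ (a i)` positive, `−ψ c` negative
        have hai : 0 < ψ (a i) := hi.mpr hc
        refine isotropicDiag_of_pos_of_neg (i := e.symm (Sum.inl i)) (j := e.symm (Sum.inr (Sum.inr ()))) ?_ ?_
        · simpa [q] using hai
        · simp [q, hc]
  rw [isotropicDiag_comp_equiv] at hiso
  obtain ⟨x, hx0, hx⟩ := hiso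
  rw [Fintype.sum_sum_type, Fintype.sum_sum_type,
    Fintype.sum_unique fun u : Unit => q (Sum.inr (Sum.inr u)) * x (Sum.inr (Sum.inr u)) ^ 2] at hx
  simp only [hq, Sum.elim_inl, Sum.elim_inr] at hx
  -- `zᵢ = x_{i,0} + x_{i,1} y` and `∑ aᵢ N(zᵢ) = c x_∗²`
  set z : ι → K := fun i => algebraMap (maximalRealSubfield K) K (x (Sum.inl i)) +
    algebraMap (maximalRealSubfield K) K (x (Sum.inr (Sum.inl i))) * y with hz
  have hN : ∀ i, z i * star (z i) =
      algebraMap (maximalRealSubfield K) K (x (Sum.inl i) ^ 2 - θ * x (Sum.inr (Sum.inl i)) ^ 2) :=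
    fun i => mul_star_eq_sub hθ hy _ _
  have key : ∑ i, algebraMap (maximalRealSubfield K) K (a i) * (z i * star (z i)) =
      algebraMap (maximalRealSubfield K) K (c * x (Sum.inr (Sum.inr ())) ^ 2) := by
    simp_rw [hN]
    simp_rw [← map_mul]
    rw [← map_sum]
    congr 1
    have hsplit : ∑ i, a i * (x (Sum.inl i) ^ 2 - θ * x (Sum.inr (Sum.inl i)) ^ 2) =
        ∑ i, a i * x (Sum.inl i) ^ 2 + ∑ i, -(a i * θ) * x (Sum.inr (Sum.inl i)) ^ 2 := by
      rw [← Finset.sum_add_distrib]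
      refine Finset.sum_congr rfl fun i _ => ?_
      ring
    rw [hsplit]
    linear_combination hx
  by_cases h4 : x (Sum.inr (Sum.inr ())) = 0
  · -- the hermitian form is isotropic
    rw [h4] at key
    simp only [ne_eq, OfNat.ofNat_ne_zero, not_false_eq_true, zero_pow, mul_zero, map_zero] at key
    have hz0 : z ≠ 0 := by
      intro hz0
      apply hx0
      funext j
      rcases j with i | i | u
      · exact (eq_zero_of_add_mul_eq_zero hy (congrFun hz0 i)).1
      · exact (eq_zero_of_add_mul_eq_zero hy (congrFun hz0 i)).2
      · exact h4
    haveI : NeZero (2 : K) := ⟨two_ne_zero⟩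
    have hsa : ∀ i, star (algebraMap (maximalRealSubfield K) K (a i)) = algebraMap (maximalRealSubfield K) K (a i) :=
      fun i => complexConj_apply_eq_self K (a i)
    have hA0 : ∀ i, algebraMap (maximalRealSubfield K) K (a i) ≠ 0 := fun i => (map_ne_zero _).mpr (ha0 i)
    have hsc : star (algebraMap (maximalRealSubfield K) K c) = algebraMap (maximalRealSubfield K) K c :=
      complexConj_apply_eq_self K c
    exact exists_sum_mul_star_eq_of_isotropic hsa hA0 hz0 key hsc
  · -- divide by `x_∗`
    set d : K := algebraMap (maximalRealSubfield K) K (x (Sum.inr (Sum.inr ()))) with hd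
    have hd0 : d ≠ 0 := (map_ne_zero _).mpr h4
    have hsd : star d = d := complexConj_apply_eq_self K _
    refine ⟨fun i => z i / d, ?_⟩
    have : ∀ i, algebraMap (maximalRealSubfield K) K (a i) * (z i / d * star (z i / d)) =
        algebraMap (maximalRealSubfield K) K (a i) * (z i * star (z i)) / (d * d) := by
      intro i
      rw [star_div₀, hsd]
      field_simp
    simp_rw [this]
    rw [← Finset.sum_div, key, hd, map_mul, map_pow, sq, mul_div_cancel_right₀ _ (mul_ne_zero hd0 hd0)]

end Represent

end Summit.Ventures.HodgeRepro2.T5GlobalRepresentationHM
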